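import Mathlib
import HarnessLib
import Literature.MathematicalPhysics.StatisticalMechanics.RenormalisationMapKernelSecondDiffFamilies
import Literature.MathematicalPhysics.StatisticalMechanics.RenormalisationMapRemainderRegroup
import Literature.MathematicalPhysics.StatisticalMechanics.ReblockingIndexSplit
import Literature.MathematicalPhysics.StatisticalMechanics.ReblockingCounting
import Literature.MathematicalPhysics.StatisticalMechanics.LinearisedMap

/-!
# The SINGLE-BLOCK family of `K_{k+1}` for FOUR STEP KERNELS (kernel SECOND DIFFERENCE) at a fixed intermediate
# Hamiltonian, block form ([ABKM19] Theorem 6.8 (single blocks) ⊗ Lemma 8.4 (ℓ = 2); (12.53) at `ℓ = 2`)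

In the four-family linear decomposition of `nextK(μ; e^{−H}, e^{−H̃}, K)(U)` (`RenormalisationMapFreeHtLinearDecomposition`) the
single-block family is `Σ_{B̄ = U} Σ_{X₁ ∈ {∅, B}} p_B(H̃)(1−e^{−H̃})^{X₁} R P₂(e^{−H},K)(B∖X₁)`; its second difference over four
step kernels `𝒞a, 𝒞b, 𝒞c, 𝒞e` (same `(H̃, H, K)`) carries one factor `(R_a − R_b − R_c + R_e)P₂(B)` per block (the `X₁ = B`
term is kernel-free).  The second-order subsum tool (`tayNormLE_subsum_reblockTerm_kernel_secondDiff_abkm`) on the block family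
and the evaluation `b_{P₂}(B) = 8e^{1/4}‖H‖_{k,0} + C·A^{−1}` (`𝓟_k(B) = {∅, B}`) give, in BLOCK FORM (the family is empty
unless `U` is a single `(k+1)`-block, where `|U|_k = L^d` and `A·A^{−|U|_{k+1}} = 1`):

* **`tayNormLE_singleBlock_kernelSecondDiff_abkm_blockFree`** —
  `≤ 2L^d·e^{(L^d+1)/4}·(8e^{1/4}‖H‖_{k,0} + C·A^{−1})·ℓ·κ_p·(A·A^{−|U|_{k+1}})`, linear in the second-order pair constant
  `ℓ` and first order in `(‖H‖, C)`.

Everything is proved; no named fact.  Honest scope: block B4 of the stub `stub_f4l2ShrinkLoc` of the crux child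
`TwoKernelSkBound` (route `Summits/HubbardSuperconductivity/…/Theses/ComplexGFFStiffness`, stiffness of a complex Gaussian gradient
field via the [ABKM19] RG); nothing about superconductivity in the Hubbard model is claimed.

## References
* S. Adams, S. Buchholz, R. Kotecký, S. Müller, arXiv:1910.13564, Theorem 6.8, Lemma 8.4, Ch. 10.1 (10.3)–(10.5),
  Lemma 12.6 (12.53) [AdamsBuchholzKoteckyMuller2019].
-/

noncomputable section

namespace Literature.MathematicalPhysics.StatisticalMechanics.GradientRG

open scoped BigOperators Classical
open Finset Matrix
open Literature.MathematicalPhysics.StatisticalMechanics.TorusPolymer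
  (IsPolymer blocks polys bprod blockOf thicken reblock mem_polys mem_blocks numBlocks isPolymer_blockOf
    card_blocks_eq_numBlocks blocks_blockOf empty_mem_polys reblock_empty subset_thicken
    bprod_empty blocks_empty blocks_mono self_mem_polys)
open Literature.Barriers.CriticalPhenomena.LongRangePhi4.Polymer (IsConn components components_empty)
open Literature.MathematicalPhysics.QuantumFieldTheory

variable {d M : ℕ} [NeZero M]

set_option maxHeartbeats 1600000 in
/-- **Single-block family, kernel second difference, block form** (module docstring): torus data (`d ≥ 3`, `L` odd,
`L ≥ 2^{d+3}+16R`, `R ≥ 2`, `M = L^N`, `k+1 ≤ N`), four step kernels with `StepKernelBounds` and the second-order pair property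
`hdiff` on `k`-polymers `Y ⊆ U + [−r,r]^d` (constant `b·ℓ·κ_p^{|Y|_k}`), `U` a `(k+1)`-polymer, `‖H̃‖_{k,0} ≤ τ ≤ 1/16`,
`‖H‖_{k,0} ≤ 1/16`, admissible `K` (`‖K‖_k ≤ C`, `K(∅) = 1`), `A ≥ 1`.
[cite: AdamsBuchholzKoteckyMuller2019, Theorem 6.8 / Lemma 8.4 / Lemma 12.6 (12.53)] -/
theorem tayNormLE_singleBlock_kernelSecondDiff_abkm_blockFree {L N Mord R n p r₀ : ℕ}
    {θbar lam μ δ₁ δ₀ A𝒫 A𝒫a A𝒫b A𝒫c A𝒫e C₂a C₂b C₂c C₂e h A : ℝ}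
    {𝒞 : ℕ → (Fin d → ZMod M) → ℝ} (hd : 3 ≤ d) (hLodd : Odd L) (hL : 2 ^ (d + 3) + 16 * R ≤ L)
    (hR2 : 2 ≤ R) (hM : M = L ^ N) {k : ℕ} (hkN : k + 1 ≤ N)
    {𝒞a 𝒞b 𝒞c 𝒞e : (Fin d → ZMod M) → ℝ}
    (hSa : StepKernelBounds (abkmWeightData L N Mord R θbar (schedDelta δ₀ δ₁ N) 𝒞) L k A𝒫a C₂a 𝒞a)
    (hSb : StepKernelBounds (abkmWeightData L N Mord R θbar (schedDelta δ₀ δ₁ N) 𝒞) L k A𝒫b C₂b 𝒞b)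
    (hSc : StepKernelBounds (abkmWeightData L N Mord R θbar (schedDelta δ₀ δ₁ N) 𝒞) L k A𝒫c C₂c 𝒞c)
    (hSe : StepKernelBounds (abkmWeightData L N Mord R θbar (schedDelta δ₀ δ₁ N) 𝒞) L k A𝒫e C₂e 𝒞e)
    (hp : d / 2 + 1 ≤ p) (hMord : d / 2 + 1 ≤ Mord)
    (hB : AbkmWeightBounds L N Mord R n θbar lam μ δ₁ δ₀ A𝒫 𝒞
      (abkmWeightData L N Mord R θbar (schedDelta δ₀ δ₁ N) 𝒞))
    (hδ₀ : 0 < δ₀) (hδ₁ : 0 < δ₁) (hh : 0 < h) (hh0 : hZeroSq d R δ₀ δ₁ ≤ h ^ 2) (hA𝒫 : 0 ≤ A𝒫a) (hA1 : 1 ≤ A)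
    {U : Finset (Fin d → ZMod M)} (hU : IsPolymer (L ^ (k + 1)) U)
    {Ht H : RelevantHamiltonian ℂ d} {τ : ℝ}
    (hHt : hamNorm (fieldWt h (L : ℝ) d k) ((L : ℝ) ^ k) (L ^ (d * k)) Ht ≤ τ) (hτ : τ ≤ 1 / 16)
    (hH : hamNorm (fieldWt h (L : ℝ) d k) ((L : ℝ) ^ k) (L ^ (d * k)) H ≤ 1 / 16)
    {K : Finset (Fin d → ZMod M) → ((Fin d → ZMod M) → ℝ) → ℂ} {C : ℝ} (hC : 0 ≤ C)
    (hK : WeakNormLE (abkmNormParams L N Mord R p r₀ h θbar A (schedDelta δ₀ δ₁ N) 𝒞) k K C)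
    (hKfac : Factorises (L ^ k) K) (hK0 : ∀ φ, K ∅ φ = 1) (hKd : ∀ Y, ContDiff ℝ r₀ (K Y))
    (hKloc : ∀ Y, IsPolymer (L ^ k) Y → IsConn Y →
      IsGaugeLocal ((abkmNormParams L N Mord R p r₀ h θbar A (schedDelta δ₀ δ₁ N) 𝒞).gauge k Y) (K Y))
    {ℓ κp : ℝ} (hℓ : 0 ≤ ℓ) (hκp : 0 ≤ κp)
    (hdiff : ∀ X : Finset (Fin d → ZMod M), IsPolymer (L ^ k) X → X ⊆ thicken ((2 ^ d - 1) * L ^ k) U →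
      ∀ (F : ((Fin d → ZMod M) → ℝ) → ℂ) (b : ℝ), 0 ≤ b → ContDiff ℝ r₀ F →
        IsGaugeLocal ((abkmNormParams L N Mord R p r₀ h θbar A (schedDelta δ₀ δ₁ N) 𝒞).gauge k X) F →
        TayNormLE ((abkmNormParams L N Mord R p r₀ h θbar A (schedDelta δ₀ δ₁ N) 𝒞).gauge k X) r₀
          ((abkmWeightData L N Mord R θbar (schedDelta δ₀ δ₁ N) 𝒞).weight k X) F b →
          TayNormLE ((abkmNormParams L N Mord R p r₀ h θbar A (schedDelta δ₀ δ₁ N) 𝒞).gauge k X) r₀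
            ((abkmWeightData L N Mord R θbar (schedDelta δ₀ δ₁ N) 𝒞).midWeight k X)
            (fluct 𝒞a F - fluct 𝒞b F - fluct 𝒞c F + fluct 𝒞e F) (b * ℓ * κp ^ numBlocks (L ^ k) X)) :
    TayNormLE ((abkmNormParams L N Mord R p r₀ h θbar A (schedDelta δ₀ δ₁ N) 𝒞).gauge (k + 1) U) r₀
      ((abkmWeightData L N Mord R θbar (schedDelta δ₀ δ₁ N) 𝒞).weight (k + 1) U)
      (fun φ => ∑ X ∈ (blocks (L ^ k) univ).filter (fun B => TorusPolymer.closure (L * L ^ k) B = U),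
        ∑ X₁ ∈ ({∅, X} : Finset (Finset (Fin d → ZMod M))),
        (bprod (L ^ k) (fun B => expNegH Ht B φ) (U \ X) * bprod (L ^ k) (fun B => expNegH (-Ht) B φ) (X \ U) *
            (bprod (L ^ k) (fun B => 1 - expNegH Ht B φ) X₁ * fluct 𝒞a (polyP2 (L ^ k) H K (X \ X₁)) φ) -
          bprod (L ^ k) (fun B => expNegH Ht B φ) (U \ X) * bprod (L ^ k) (fun B => expNegH (-Ht) B φ) (X \ U) *
            (bprod (L ^ k) (fun B => 1 - expNegH Ht B φ) X₁ * fluct 𝒞b (polyP2 (L ^ k) H K (X \ X₁)) φ) -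
          bprod (L ^ k) (fun B => expNegH Ht B φ) (U \ X) * bprod (L ^ k) (fun B => expNegH (-Ht) B φ) (X \ U) *
            (bprod (L ^ k) (fun B => 1 - expNegH Ht B φ) X₁ * fluct 𝒞c (polyP2 (L ^ k) H K (X \ X₁)) φ) +
          bprod (L ^ k) (fun B => expNegH Ht B φ) (U \ X) * bprod (L ^ k) (fun B => expNegH (-Ht) B φ) (X \ U) *
            (bprod (L ^ k) (fun B => 1 - expNegH Ht B φ) X₁ * fluct 𝒞e (polyP2 (L ^ k) H K (X \ X₁)) φ)))
      (2 * ((L ^ d : ℕ) : ℝ) * (Real.exp (1 / 4) ^ (L ^ d) * Real.exp (1 / 4)) *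
        ((8 * Real.exp (1 / 4) * hamNorm (fieldWt h (L : ℝ) d k) ((L : ℝ) ^ k) (L ^ (d * k)) H + C * A⁻¹) * ℓ * κp) *
        (A * (abkmNormParams L N Mord R p r₀ h θbar A (schedDelta δ₀ δ₁ N) 𝒞).aFactor (k + 1) U)) := by
  have hA : 0 < A := by linarith
  set P := abkmNormParams L N Mord R p r₀ h θbar A (schedDelta δ₀ δ₁ N) 𝒞 with hP
  set W := abkmWeightData L N Mord R θbar (schedDelta δ₀ δ₁ N) 𝒞 with hW
  set T := (polys (L ^ k) univ).filter (fun X => reblock (L ^ k) (L * L ^ k) X = U) with hT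
  set T₁ := (blocks (L ^ k) univ).filter (fun B => TorusPolymer.closure (L * L ^ k) B = U) with hT₁
  set cH := 8 * Real.exp (1 / 4) * hamNorm (fieldWt h (L : ℝ) d k) ((L : ℝ) ^ k) (L ^ (d * k)) H with hcH
  -- sizes and parities
  have hMo : Odd M := by rw [hM]; exact hLodd.pow
  have hsodd : Odd (L ^ k) := hLodd.pow
  have hL0 : (0 : ℝ) < L := by exact_mod_cast hLodd.pos
  have hnn : ∀ H₀ : RelevantHamiltonian ℂ d,
      0 ≤ hamNorm (fieldWt h (L : ℝ) d k) ((L : ℝ) ^ k) (L ^ (d * k)) H₀ := fun H₀ =>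
    hamNorm_nonneg (fieldWt_pos hh hL0 d k).le (by positivity) _ H₀
  have hcH0 : 0 ≤ cH := by have := hnn H; rw [hcH]; positivity
  have hτ0 : 0 ≤ τ := (hnn Ht).trans hHt
  have he1 : (1 : ℝ) ≤ Real.exp (1 / 4) := Real.one_le_exp (by norm_num)
  have he0 : (0 : ℝ) ≤ Real.exp (1 / 4) := (Real.exp_pos _).le
  have hΔ0 : hamNorm (fieldWt h (L : ℝ) d k) ((L : ℝ) ^ k) (L ^ (d * k)) (Ht - Ht) = 0 := by
    rw [sub_self, hamNorm_zero]
  have haF : ∀ Z, P.aFactor k Z = (A ^ (blocks (L ^ k) Z).card)⁻¹ := fun Z => by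
    rw [hP, NormParams.aFactor, abkmNormParams_A, abkmNormParams_L, card_blocks_eq_numBlocks]
  -- the block family inside the index set
  set D₀ : StepData d M := ⟨L ^ k, L, 𝒞a, 0, ∅⟩ with hD₀
  have hbpi : blockPartIndex D₀ U = T₁ := rfl
  have hT₁T : T₁ ⊆ T := by
    rw [← hbpi, ← filter_reblock_isConn_card_eq_one D₀ hMo hsodd hLodd U]
    exact filter_subset _ _
  have hT₁blk : T₁ ⊆ blocks (L ^ k) U := by rw [← hbpi]; exact blockPartIndex_subset_blocks D₀ U
  have hT₁x : ∀ X ∈ T₁, ∃ x, X = blockOf (L ^ k) x := fun X hX => by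
    obtain ⟨x, -, rfl⟩ := mem_blocks.1 (mem_filter.1 hX).1; exact ⟨x, rfl⟩
  have hT₁ne : ∀ X ∈ T₁, X.Nonempty := fun X hX => by
    obtain ⟨x, rfl⟩ := hT₁x X hX; exact ⟨x, TorusPolymer.mem_blockOf_self _ x⟩
  have h𝓨 : ∀ X ∈ T₁, ({∅, X} : Finset (Finset (Fin d → ZMod M))) ⊆ polys (L ^ k) X := by
    intro X hX X₁ hX₁
    rcases mem_insert.1 hX₁ with rfl | h1
    · exact empty_mem_polys _ _
    · rw [mem_singleton.1 h1]; exact self_mem_polys (mem_polys.1 (mem_filter.1 (hT₁T hX)).1).2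
  -- the second-order subsum tool on the block family
  have htool := tayNormLE_subsum_reblockTerm_kernel_secondDiff_abkm (n := n) (lam := lam) (μ := μ) hd hLodd hL hR2 hM hkN
    hSa hSb hSc hSe hp hMord hB hδ₀ hδ₁ hh hh0 hA𝒫 hA hU (𝓧' := T₁) hT₁T
    (𝓨 := fun X => ({∅, X} : Finset (Finset (Fin d → ZMod M)))) h𝓨
    hHt hτ hH hC hK hKfac hK0 hKd hKloc hℓ hκp hdiff
  refine htool.mono ?_ (fun φ => (W.weight_pos (k + 1) U φ).le)
  -- the per-term bound
  set c' : ℝ := Real.exp (1 / 4) ^ (blocks (L ^ k) U).card * Real.exp (1 / 4) * ((cH + C * A⁻¹) * ℓ * κp) with hc'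
  have hc'0 : 0 ≤ c' := by rw [hc']; positivity
  have hmaj : ∀ X ∈ T₁, ∀ X₁ ∈ ({∅, X} : Finset (Finset (Fin d → ZMod M))),
        (((∏ _B ∈ blocks (L ^ k) (U \ X), (Real.exp (1 / 4) +
              16 * Real.exp (3 / 8) * hamNorm (fieldWt h (L : ℝ) d k) ((L : ℝ) ^ k) (L ^ (d * k)) (Ht - Ht))) -
            ∏ _B ∈ blocks (L ^ k) (U \ X), Real.exp (1 / 4)) *
            (∏ _B ∈ blocks (L ^ k) (X \ U), Real.exp (1 / 4)) *
            ((∏ _B ∈ blocks (L ^ k) X₁, 8 * Real.exp (1 / 4) * τ) *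
              ((∑ Y ∈ polys (L ^ k) (X \ X₁), (∏ _B ∈ blocks (L ^ k) ((X \ X₁) \ Y),
                8 * Real.exp (1 / 4) * hamNorm (fieldWt h (L : ℝ) d k) ((L : ℝ) ^ k) (L ^ (d * k)) H) *
                ∏ Z ∈ components Y, C *
                  (abkmNormParams L N Mord R p r₀ h θbar A (schedDelta δ₀ δ₁ N) 𝒞).aFactor k Z) *
                A𝒫a ^ numBlocks (L ^ k) (X \ X₁))) +
          (∏ _B ∈ blocks (L ^ k) (U \ X), Real.exp (1 / 4)) *
            ((∏ _B ∈ blocks (L ^ k) (X \ U), (Real.exp (1 / 4) +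
              16 * Real.exp (3 / 8) * hamNorm (fieldWt h (L : ℝ) d k) ((L : ℝ) ^ k) (L ^ (d * k)) (Ht - Ht))) -
              ∏ _B ∈ blocks (L ^ k) (X \ U), Real.exp (1 / 4)) *
            ((∏ _B ∈ blocks (L ^ k) X₁, 8 * Real.exp (1 / 4) * τ) *
              ((∑ Y ∈ polys (L ^ k) (X \ X₁), (∏ _B ∈ blocks (L ^ k) ((X \ X₁) \ Y),
                8 * Real.exp (1 / 4) * hamNorm (fieldWt h (L : ℝ) d k) ((L : ℝ) ^ k) (L ^ (d * k)) H) *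
                ∏ Z ∈ components Y, C *
                  (abkmNormParams L N Mord R p r₀ h θbar A (schedDelta δ₀ δ₁ N) 𝒞).aFactor k Z) *
                A𝒫a ^ numBlocks (L ^ k) (X \ X₁))) +
          (∏ _B ∈ blocks (L ^ k) (U \ X), Real.exp (1 / 4)) * (∏ _B ∈ blocks (L ^ k) (X \ U), Real.exp (1 / 4)) *
            (((∏ _B ∈ blocks (L ^ k) X₁, (8 * Real.exp (1 / 4) * τ +
                16 * Real.exp (3 / 8) * hamNorm (fieldWt h (L : ℝ) d k) ((L : ℝ) ^ k) (L ^ (d * k)) (Ht - Ht))) -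
              ∏ _B ∈ blocks (L ^ k) X₁, 8 * Real.exp (1 / 4) * τ) *
              ((∑ Y ∈ polys (L ^ k) (X \ X₁), (∏ _B ∈ blocks (L ^ k) ((X \ X₁) \ Y),
                8 * Real.exp (1 / 4) * hamNorm (fieldWt h (L : ℝ) d k) ((L : ℝ) ^ k) (L ^ (d * k)) H) *
                ∏ Z ∈ components Y, C *
                  (abkmNormParams L N Mord R p r₀ h θbar A (schedDelta δ₀ δ₁ N) 𝒞).aFactor k Z) *
                A𝒫a ^ numBlocks (L ^ k) (X \ X₁))) +
          (∏ _B ∈ blocks (L ^ k) (U \ X), Real.exp (1 / 4)) * (∏ _B ∈ blocks (L ^ k) (X \ U), Real.exp (1 / 4)) *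
            ((∏ _B ∈ blocks (L ^ k) X₁, 8 * Real.exp (1 / 4) * τ) *
              (if X \ X₁ = ∅ then 0 else
                (∑ Y ∈ polys (L ^ k) (X \ X₁), (∏ _B ∈ blocks (L ^ k) ((X \ X₁) \ Y),
                  8 * Real.exp (1 / 4) * hamNorm (fieldWt h (L : ℝ) d k) ((L : ℝ) ^ k) (L ^ (d * k)) H) *
                  ∏ Z ∈ components Y, C *
                    (abkmNormParams L N Mord R p r₀ h θbar A (schedDelta δ₀ δ₁ N) 𝒞).aFactor k Z) *
                  ℓ * κp ^ numBlocks (L ^ k) (X \ X₁)))) ≤ c' := by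
    intro X hX X₁ hX₁
    obtain ⟨x, rfl⟩ := hT₁x X hX
    have hXne : blockOf (L ^ k) x ≠ ∅ := (hT₁ne _ hX).ne_empty
    -- the three `H̃`-variation summands vanish
    rw [hΔ0]
    simp only [mul_zero, add_zero, sub_self, zero_mul, zero_add]
    -- prefactor products
    have hp1 : (∏ _B ∈ blocks (L ^ k) (U \ blockOf (L ^ k) x), Real.exp (1 / 4)) ≤
        Real.exp (1 / 4) ^ (blocks (L ^ k) U).card := by
      rw [prod_const]
      exact pow_le_pow_right₀ he1 (card_le_card (blocks_mono _ sdiff_subset))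
    have hp2 : (∏ _B ∈ blocks (L ^ k) (blockOf (L ^ k) x \ U), Real.exp (1 / 4)) ≤ Real.exp (1 / 4) := by
      rw [prod_const]
      have hc : (blocks (L ^ k) (blockOf (L ^ k) x \ U)).card ≤ 1 := by
        have := card_le_card (blocks_mono (L ^ k) (sdiff_subset (s := blockOf (L ^ k) x) (t := U)))
        rw [blocks_blockOf, card_singleton] at this
        exact this
      calc Real.exp (1 / 4) ^ (blocks (L ^ k) (blockOf (L ^ k) x \ U)).card
          ≤ Real.exp (1 / 4) ^ 1 := pow_le_pow_right₀ he1 hc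
        _ = Real.exp (1 / 4) := pow_one _
    have hp10 : 0 ≤ ∏ _B ∈ blocks (L ^ k) (U \ blockOf (L ^ k) x), Real.exp (1 / 4) := prod_nonneg fun _ _ => he0
    have hp20 : 0 ≤ ∏ _B ∈ blocks (L ^ k) (blockOf (L ^ k) x \ U), Real.exp (1 / 4) := prod_nonneg fun _ _ => he0
    rcases mem_insert.1 hX₁ with rfl | h1
    · -- `X₁ = ∅`: the kernel slot on the block
      rw [sdiff_empty, if_neg hXne, blocks_empty, prod_empty, one_mul]
      -- `b_{P₂}(B) = c_H + C A⁻¹`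
      have hbP2 : (∑ Y ∈ polys (L ^ k) (blockOf (L ^ k) x), (∏ _B ∈ blocks (L ^ k) (blockOf (L ^ k) x \ Y), cH) *
          ∏ Z ∈ components Y, C * P.aFactor k Z) = cH + C * A⁻¹ := by
        rw [TorusPolymer.polys_blockOf, sum_pair (Ne.symm hXne)]
        have hcB : IsConn (blockOf (L ^ k) x) := TorusPolymer.isConn_blockOf hMo hsodd x
        rw [sdiff_empty, Finset.sdiff_self, blocks_blockOf, prod_singleton, blocks_empty, prod_empty, components_empty,
          prod_empty, hcB.components_eq, prod_singleton, haF, blocks_blockOf, card_singleton, pow_one]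
        ring
      have hnb : numBlocks (L ^ k) (blockOf (L ^ k) x) = 1 := by
        rw [← card_blocks_eq_numBlocks, blocks_blockOf, card_singleton]
      rw [hbP2, hnb, pow_one]
      have hin : 0 ≤ (cH + C * A⁻¹) * ℓ * κp := by positivity
      calc (∏ _B ∈ blocks (L ^ k) (U \ blockOf (L ^ k) x), Real.exp (1 / 4)) *
            (∏ _B ∈ blocks (L ^ k) (blockOf (L ^ k) x \ U), Real.exp (1 / 4)) * ((cH + C * A⁻¹) * ℓ * κp)
          ≤ Real.exp (1 / 4) ^ (blocks (L ^ k) U).card * Real.exp (1 / 4) * ((cH + C * A⁻¹) * ℓ * κp) :=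
            mul_le_mul_of_nonneg_right (mul_le_mul hp1 hp2 hp20 (by positivity)) hin
        _ = c' := by rw [hc']
    · -- `X₁ = B`: the inner polymer is empty, the kernel slot vanishes
      rw [mem_singleton.1 h1, Finset.sdiff_self, if_pos rfl, mul_zero, mul_zero]
      exact hc'0
  refine (sum_le_sum fun X hX => sum_le_sum fun X₁ hX₁ => hmaj X hX X₁ hX₁).trans ?_
  -- `Σ_{T₁} Σ_{{∅,B}} c' = 2 |T₁| c' ≤ 2 |U|_k c'`
  have hpair : ∀ X ∈ T₁, ∑ _X₁ ∈ ({∅, X} : Finset (Finset (Fin d → ZMod M))), c' = 2 * c' := by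
    intro X hX
    rw [sum_pair (hT₁ne X hX).ne_empty.symm]; ring
  rw [sum_congr rfl hpair, sum_const, nsmul_eq_mul]
  have hcardT : T₁.card ≤ (blocks (L ^ k) U).card := card_le_card hT₁blk
  -- block form
  by_cases hne : T₁.Nonempty
  · obtain ⟨B, hB'⟩ := hne
    obtain ⟨x, rfl⟩ := hT₁x B hB'
    have hcl : TorusPolymer.closure (L * L ^ k) (blockOf (L ^ k) x) = U := (mem_filter.1 hB').2
    rw [closure_blockOf_mul hsodd hLodd x] at hcl
    have hcard1 : (blocks (L * L ^ k) U).card = 1 := by rw [← hcl, blocks_blockOf, card_singleton]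
    have hnb : numBlocks (P.L ^ (k + 1)) U = 1 := by
      show numBlocks (L ^ (k + 1)) U = 1
      rw [← card_blocks_eq_numBlocks, pow_succ', hcard1]
    have haFU : A * P.aFactor (k + 1) U = 1 := by
      show A * (A ^ numBlocks (P.L ^ (k + 1)) U)⁻¹ = 1
      rw [hnb, pow_one, mul_inv_cancel₀ hA.ne']
    have hMeq : M = L * L ^ k * L ^ (N - k - 1) := by
      rw [hM, ← pow_succ', ← pow_add]; congr 1; omega
    have hU' : IsPolymer (L * L ^ k) U := by rw [← pow_succ']; exact hU
    have hm0 : (blocks (L ^ k) U).card = L ^ d := by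
      rw [TorusPolymer.card_blocks_eq_mul hMeq hsodd hLodd hLodd.pow hU', hcard1, mul_one]
    rw [hm0] at hcardT
    have hcardR : (T₁.card : ℝ) ≤ ((L ^ d : ℕ) : ℝ) := by exact_mod_cast hcardT
    rw [haFU, mul_one, hc', hm0]
    have h2c : 0 ≤ 2 * (Real.exp (1 / 4) ^ L ^ d * Real.exp (1 / 4) * ((cH + C * A⁻¹) * ℓ * κp)) := by positivity
    calc (T₁.card : ℝ) * (2 * (Real.exp (1 / 4) ^ L ^ d * Real.exp (1 / 4) * ((cH + C * A⁻¹) * ℓ * κp)))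
        ≤ ((L ^ d : ℕ) : ℝ) * (2 * (Real.exp (1 / 4) ^ L ^ d * Real.exp (1 / 4) * ((cH + C * A⁻¹) * ℓ * κp))) :=
          mul_le_mul_of_nonneg_right hcardR h2c
      _ = 2 * ((L ^ d : ℕ) : ℝ) * (Real.exp (1 / 4) ^ (L ^ d) * Real.exp (1 / 4)) * ((cH + C * A⁻¹) * ℓ * κp) := by
          ring
  · rw [not_nonempty_iff_eq_empty] at hne
    rw [hne, card_empty, Nat.cast_zero, zero_mul]
    have haF0 : 0 ≤ P.aFactor (k + 1) U := (WeakNormLE.aFactor_pos hA (k + 1) U).le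
    positivity

end Literature.MathematicalPhysics.StatisticalMechanics.GradientRG

end
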